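import Mathlib
import HarnessLib
import Summits.AnomalousDissipation.AnomalousDissipation.Theses.DyadicWallCascade
import Summits.AnomalousDissipation.AnomalousDissipation.Theorems.SteadyWeakLimitSteadyToSummit
import Summits.AnomalousDissipation.AnomalousDissipation.Theorems.DyadicWallCascadeViscousContinuationStubZeroStressOfHalfTurn
import Summits.AnomalousDissipation.AnomalousDissipation.Theorems.DyadicWallCascadeViscousContinuationStubZeroStressSplit

/-!
# Re-cut certificate for route DyadicWallCascade (line `SketchIdeator4`, lead a1) — crux stmt-AnomalousDissipation-17917

For the TENURE PLANNER.  The two open stubs of the zero-stress-split skeleton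
(`Lines/SketchIdeator4.lean`) are the two items of the re-cut recommended by PLANNER-FINDING-r2-k4
(R1/R2).  This file writes them in the ROUTE'S OWN `let`-style (paste-ready item signatures) and
checks, sorry-free, that

* `closes_recut` — the re-cut route still reaches the Statement:
  `HalfTurnSymmetricHierarchy → ZeroStressContinuation → DyadicRealisation → AnomalousDissipation`,
  through the LANDED `stub_zeroStressOfHalfTurn` (p159591: symmetry ⇒ zero stress) and
  `steadyToSummit_proof`, exactly as today's `closes` does;
* `halfSpaceHierarchy_of_halfTurnSymmetricHierarchy` — the new #2 refines the old #2 (a refutation of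
  the old #2 still kills the route; a witness of the new one is a witness of the old one);
* `zeroStressContinuation_of_viscousContinuation` — the new #3 is WEAKER than the old #3 (every proof
  of today's crux proves it), and by the LANDED certificate `stub_zeroStressSplit` (p159368) the
  difference is exactly the Euler-side STRESS REMOVAL, which the new #2 makes moot.

Proposed item texts (verbatim the `def`s below, bodies only):
  #2' `HalfTurnSymmetricHierarchy` — today's #2 block ∧ half-turn covariance on `H`
       (`V (-x, -y, z) = (-V₀, -V₁, V₂)(x, y, z)`; the `C₂` part of the p4m design; p4m may be added, it is
       not needed for zero stress);
  #3' `ZeroStressContinuation` — (today's #2 block ∧ `∫V₂V₀ = ∫V₂V₁ = 0` on the unit square of `z = 1`)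
       → today's `ViscousWallProfile` block.
-/

set_option linter.dupNamespace false

noncomputable section

namespace Summit.AnomalousDissipation.AnomalousDissipation.Cruxes.ViscousContinuation.ZeroStressSplit.Recut

open MeasureTheory Set
open Summit.AnomalousDissipation.AnomalousDissipation.Theses.DyadicWallCascade
open Summit.AnomalousDissipation.AnomalousDissipation.Theorems

/-- **Proposed crux #2'** (route `let`-style): a half-space hierarchy covariant under the half-turn
about the vertical axis. -/
def HalfTurnSymmetricHierarchy : Prop :=
  ∃ (V : EuclideanSpace ℝ (Fin 3) → EuclideanSpace ℝ (Fin 3)) (Q : EuclideanSpace ℝ (Fin 3) → ℝ) (C F : ℝ), let H : Set (EuclideanSpace ℝ (Fin 3)) := {X | 0 < X 2}; let e : Fin 3 → EuclideanSpace ℝ (Fin 3) := fun i => EuclideanSpace.single i (1 : ℝ); let pt : ℝ × ℝ → EuclideanSpace ℝ (Fin 3) := fun q => !₂[q.1, q.2, (1 : ℝ)]; (ContDiffOn ℝ ((⊤ : ℕ∞) : WithTop ℕ∞) V H ∧ ContDiffOn ℝ ((⊤ : ℕ∞) : WithTop ℕ∞) Q H ∧ (∀ X ∈ H, ‖V X‖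 ≤ C ∧ |Q X| ≤ C) ∧ (∀ X ∈ H, ∑ i : Fin 3, (fderiv ℝ V X (e i)) i = 0) ∧ (∀ X ∈ H, (fderiv ℝ V X) (V X) + gradient Q X = 0) ∧ (∀ X ∈ H, V ((2 : ℝ) • X) = V X ∧ Q ((2 : ℝ) • X) = Q X) ∧ (∀ X : EuclideanSpace ℝ (Fin 3), 1 ≤ X 2 → X 2 ≤ 2 → V (X + e 0) = V X ∧ V (X + e 1) = V X ∧ Q (X + e 0) = Q X ∧ Q (X + e 1) = Q X) ∧ (∫ q in Set.Icc (0 : ℝ) 1 ×ˢ Set.Icc (0 : ℝ) 1, (V (pt q)) 2 = 0) ∧ F ≠ 0 ∧ (∫ q in Set.Icc (0 : ℝ) 1 ×ˢ Set.Icc (0 : ℝ) 1, (V (pt q)) 2 * (‖V (pt q)‖ ^ 2 / 2 + Q (pt q)) = F)) ∧ (∀ X ∈ H, V (!₂[-(X 0), -(X 1), X 2]) = !₂[-((V X) 0), -((V X) 1), (V X) 2])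

/-- **Proposed crux #3'** (route `let`-style): a ZERO-STRESS half-space hierarchy continues to a viscous
wall profile (conclusion = today's `ViscousWallProfile` block, verbatim). -/
def ZeroStressContinuation : Prop :=
  (∃ (V : EuclideanSpace ℝ (Fin 3) → EuclideanSpace ℝ (Fin 3)) (Q : EuclideanSpace ℝ (Fin 3) → ℝ) (C F : ℝ), let H : Set (EuclideanSpace ℝ (Fin 3)) := {X | 0 < X 2}; let e : Fin 3 → EuclideanSpace ℝ (Fin 3) := fun i => EuclideanSpace.single i (1 : ℝ); let pt : ℝ × ℝ → EuclideanSpace ℝ (Fin 3) := fun q => !₂[q.1, q.2, (1 : ℝ)]; (ContDiffOn ℝ ((⊤ : ℕ∞) : WithTop ℕ∞) V H ∧ ContDiffOn ℝ ((⊤ : ℕ∞) : WithTop ℕ∞) Q H ∧ (∀ X ∈ H, ‖V X‖ ≤ C ∧ |Q X| ≤ C) ∧ (∀ X ∈ H, ∑ i : Fin 3, (fderiv ℝ V X (e i)) i = 0) ∧ (∀ X ∈ H, (fderiv ℝ V X) (V X) + gradient Q X = 0) ∧ (∀ X ∈ H, V ((2 : ℝ) • X) = V X ∧ Q ((2 :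 ℝ) • X) = Q X) ∧ (∀ X : EuclideanSpace ℝ (Fin 3), 1 ≤ X 2 → X 2 ≤ 2 → V (X + e 0) = V X ∧ V (X + e 1) = V X ∧ Q (X + e 0) = Q X ∧ Q (X + e 1) = Q X) ∧ (∫ q in Set.Icc (0 : ℝ) 1 ×ˢ Set.Icc (0 : ℝ) 1, (V (pt q)) 2 = 0) ∧ F ≠ 0 ∧ (∫ q in Set.Icc (0 : ℝ) 1 ×ˢ Set.Icc (0 : ℝ) 1, (V (pt q)) 2 * (‖V (pt q)‖ ^ 2 / 2 + Q (pt q)) = F)) ∧ (∫ q in Set.Icc (0 : ℝ) 1 ×ˢ Set.Icc (0 : ℝ) 1, (V (pt q)) 2 * (V (pt q)) 0 = 0) ∧ (∫ q in Set.Icc (0 : ℝ) 1 ×ˢ Set.Icc (0 : ℝ) 1, (V (pt q)) 2 * (V (pt q)) 1 = 0)) → ViscousWallProfile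

/-- The new #2 refines the old #2 (projection). -/
theorem halfSpaceHierarchy_of_halfTurnSymmetricHierarchy :
    HalfTurnSymmetricHierarchy → HalfSpaceHierarchy := by
  rintro ⟨V, Q, C, F, hB, -⟩
  exact ⟨V, Q, C, F, hB⟩

/-- The new #3 is weaker than the old #3 (a zero-stress hierarchy is a hierarchy). -/
theorem zeroStressContinuation_of_viscousContinuation :
    ViscousContinuation → ZeroStressContinuation := by
  rintro h ⟨V, Q, C, F, hB, -, -⟩
  exact h ⟨V, Q, C, F, hB⟩

/-- The new #2 delivers a ZERO-STRESS hierarchy (landed `stub_zeroStressOfHalfTurn`, p159591), so the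
new #3 applies to it. -/
theorem viscousWallProfile_of_recut (h₂ : HalfTurnSymmetricHierarchy) (h₃ : ZeroStressContinuation) :
    ViscousWallProfile := by
  obtain ⟨V, Q, C, F, hB, hsym⟩ := h₂
  obtain ⟨hVs, hQs, hbdd, hVdiv, hEul, hdil, hper, hmass, hF, hflux⟩ := hB
  have hz := stub_zeroStressOfHalfTurn V hVs
    (fun X h1 h2 => ⟨(hper X h1 h2).1, (hper X h1 h2).2.1⟩) (fun X hX => hsym X hX)
  exact h₃ ⟨V, Q, C, F, ⟨hVs, hQs, hbdd, hVdiv, hEul, hdil, hper, hmass, hF, hflux⟩, hz.1, hz.2⟩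

/-- **The re-cut route reaches the Statement** (same shape as today's `closes`). -/
theorem closes_recut (h₂ : HalfTurnSymmetricHierarchy) (h₃ : ZeroStressContinuation)
    (h₄ : DyadicRealisation) : _root_.AnomalousDissipation := by
  have hS := Summit.AnomalousDissipation.AnomalousDissipation.Theorems.steadyToSummit_proof
  unfold Summit.AnomalousDissipation.AnomalousDissipation.Theses.SteadyWeakLimit.SteadyToSummit at hS
  exact hS (h₄ (viscousWallProfile_of_recut h₂ h₃))

/-- Bookkeeping against today's items (landed certificate `stub_zeroStressSplit`, p159368): today's
crux #3 is EXACTLY "stress removal ∧ new #3"; the new #2 makes the stress-removal conjunct moot. -/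
theorem viscousContinuation_iff_stressRemoval_and_recut :
    ViscousContinuation ↔
      ((HalfSpaceHierarchy →
        ∃ (V : EuclideanSpace ℝ (Fin 3) → EuclideanSpace ℝ (Fin 3)) (Q : EuclideanSpace ℝ (Fin 3) → ℝ)
          (C F : ℝ),
          (ContDiffOn ℝ ((⊤ : ℕ∞) : WithTop ℕ∞) V {X : EuclideanSpace ℝ (Fin 3) | 0 < X 2} ∧
            ContDiffOn ℝ ((⊤ : ℕ∞) : WithTop ℕ∞) Q {X : EuclideanSpace ℝ (Fin 3) | 0 < X 2} ∧
            (∀ X : EuclideanSpace ℝ (Fin 3), 0 < X 2 → ‖V X‖ ≤ C ∧ |Q X| ≤ C) ∧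
            (∀ X : EuclideanSpace ℝ (Fin 3), 0 < X 2 →
              ∑ i : Fin 3, (fderiv ℝ V X (EuclideanSpace.single i (1 : ℝ))) i = 0) ∧
            (∀ X : EuclideanSpace ℝ (Fin 3), 0 < X 2 → (fderiv ℝ V X) (V X) + gradient Q X = 0) ∧
            (∀ X : EuclideanSpace ℝ (Fin 3), 0 < X 2 →
              V ((2 : ℝ) • X) = V X ∧ Q ((2 : ℝ) • X) = Q X) ∧
            (∀ X : EuclideanSpace ℝ (Fin 3), 1 ≤ X 2 → X 2 ≤ 2 →
              V (X + EuclideanSpace.single 0 (1 : ℝ)) = V X ∧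
                V (X + EuclideanSpace.single 1 (1 : ℝ)) = V X ∧
                  Q (X + EuclideanSpace.single 0 (1 : ℝ)) = Q X ∧
                    Q (X + EuclideanSpace.single 1 (1 : ℝ)) = Q X) ∧
            (∫ q in Set.Icc (0 : ℝ) 1 ×ˢ Set.Icc (0 : ℝ) 1, (V !₂[q.1, q.2, (1 : ℝ)]) 2 = 0) ∧ F ≠ 0 ∧
            (∫ q in Set.Icc (0 : ℝ) 1 ×ˢ Set.Icc (0 : ℝ) 1,
              (V !₂[q.1, q.2, (1 : ℝ)]) 2 *
                (‖V !₂[q.1, q.2, (1 : ℝ)]‖ ^ 2 / 2 + Q !₂[q.1, q.2, (1 : ℝ)]) = F)) ∧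
          (∫ q in Set.Icc (0 : ℝ) 1 ×ˢ Set.Icc (0 : ℝ) 1,
            (V !₂[q.1, q.2, (1 : ℝ)]) 2 * (V !₂[q.1, q.2, (1 : ℝ)]) 0 = 0) ∧
          (∫ q in Set.Icc (0 : ℝ) 1 ×ˢ Set.Icc (0 : ℝ) 1,
            (V !₂[q.1, q.2, (1 : ℝ)]) 2 * (V !₂[q.1, q.2, (1 : ℝ)]) 1 = 0)) ∧
      ZeroStressContinuation) := by
  have hsplit := Summit.AnomalousDissipation.AnomalousDissipation.Theorems.stub_zeroStressSplit
  constructor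
  · intro h
    exact ⟨(hsplit.1 h).1, zeroStressContinuation_of_viscousContinuation h⟩
  · rintro ⟨h₁, h₃⟩ hH
    obtain ⟨V, Q, C, F, hB, hz0, hz1⟩ := h₁ hH
    exact h₃ ⟨V, Q, C, F, hB, hz0, hz1⟩

end Summit.AnomalousDissipation.AnomalousDissipation.Cruxes.ViscousContinuation.ZeroStressSplit.Recut

end
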